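import Mathlib
import HarnessLib

/-!
# DAG node N07 (road R0′ at the record; the `hker` ∕ `hpos` letter) — ANALYTIC CORE OF THE POINT-FEASIBILITY LEMMA (P),
# part 1: positivity of aliased alternating sums over hill-shaped data (vocabulary-free, integral-free)

Width seat `pub-ymgap-dag-n07-w7` (g2), `--supports stmt-QuantumFields-20542 --as helper`; count-neutral.

WHY.  `…N07FlatHFeasibility.exists_admissible_grad_of_flatKernel` (this lineage) reduces feasibility of the admissible
pure gauge on road R0′ to the displayed binder `hker : ∂_c(Eμ) = 0 → R∂*∂μ = 0 → ∂μ = 0`; at the RECORD `hker` is the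
lattice lemma (P) «`μ` constant on the block centres ∧ `Δ²μ` block-constant ⇒ `μ` constant» (lane note
LOCATED-POINT-FEASIBILITY, dag-n07-e g20), and at one level with odd block side `L` block-Fourier analysis reduces (P) to
`K(θ) ≠ 0`, `K(θ) = L^{-d} Σ_{m ∈ [L]^d} Π_κ [(−1)^{m_κ} sin(θ_κ∕2) ∕ s_{m_κ}(θ_κ)] · λ(ξ_m)^{−2}`,
`s_m(ϑ) = sin((ϑ + 2πm)∕(2L))`, `λ(ξ_m) = 4 Σ_κ s_{m_κ}(θ_κ)²`.  THIS FILE is the quantitative heart of «`K(θ) > 0`»: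
§1 ★ `valleyAlt_sum_pos` — an alternating sum of ODD length of a positive VALLEY-SHAPED sequence is positive (pair the
terms from both ends; one `+` term survives);  §2 the classes `iterMono k : Set (ℝ → ℝ)` of `k`-MONOTONE functions on
`(0,∞)` (positive, every forward difference `x ↦ F x − F (x+δ)`, `δ > 0`, in `iterMono (k−1)`): closure under sums,
positive multiples, products, right translations; ★ `iterMono_inv`, `iterMono_inv_mul_inv` (`x⁻¹`, `x⁻¹·x⁻¹` lie in every
class — the integral-free replacement of `λ⁻² = ∫₀^∞ t e^{−tλ} dt`);  §3 the one-coordinate TRANSFER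
`transfer L s F x = Σ_{m<L} (−1)^m ∕ s m · F (x + (s m)²)` for positive HILL-SHAPED `s` (non-decreasing on `[0,p]`,
non-increasing on `[p+1,L−1]`): ★★ `transfer_pos`, ★★ `iterMono_transfer` (`F ∈ iterMono (k+1) → transfer L s F ∈ iterMono k`:
summing out one coordinate costs one order);  §4 ★★★ `aliasCore_iterMono`, `aliasCore_pos_fin`, `aliasCore_pos`: for
finitely many positive hill-shaped `s κ`, odd `L`, `F ∈ iterMono k` for all `k`, and `J` finite non-empty,
`0 < Σ_{m : J → Fin L} (Π_κ (−1)^{m κ} ∕ s κ (m κ)) · F (Σ_κ (s κ (m κ))²)`.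
Part 2 (`…N07AliasSumPositivity`) supplies the sine data and the displayed `K(θ) > 0`.

HONEST SCOPE.  Elementary real analysis on finite sums ([folklore] throughout); nothing of [B11]∕[B6]∕[3] is asserted;
the block-Fourier reduction of (P) to `K(θ) ≠ 0`, the aliasing identity and the multi-level (P)_D are NOT here (lane
owner's (t3) ∕ open); `hker`, stub 1, K0⁷∕K1⁷ NOT closed; N07 not discharged; nothing continuum ∕ OS ∕ mass gap.
Context: T. Bałaban, CMP **96** (1984) 223–250 [Balaban1984PropagatorsII] (2.22) p.226; CMP **102** (1985) 277–309
[Balaban1985Variational] (45)–(46) p.285 — nothing is cited as a hypothesis.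
-/

set_option autoImplicit false

noncomputable section

open Finset

namespace Summit.QuantumFields.YangMills.Theorems.N07AliasSumPositivity

/-! ## §1  Alternating sums of odd length over valley-shaped positive sequences -/

/-- An alternating sum of odd length `2r+1` whose terms are non-decreasing from index `1` on is at least its first
term: `a₀ + Σ_{i ≤ r} (a_{2i} − a_{2i−1}) ≥ a₀`. [folklore] -/
theorem first_le_alt_sum_of_monotoneFrom_one (a : ℕ → ℝ) (r : ℕ)
    (hup : ∀ m m', 1 ≤ m → m ≤ m' → m' ≤ 2 * r → a m ≤ a m') :
    a 0 ≤ ∑ m ∈ range (2 * r + 1), (-1 : ℝ) ^ m * a m := by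
  induction r with
  | zero => simp
  | succ r ih =>
    have h1 : a 0 ≤ ∑ m ∈ range (2 * r + 1), (-1 : ℝ) ^ m * a m := ih (fun m m' h1 h2 h3 => hup m m' h1 h2 (by omega))
    have h2 : a (2 * r + 1) ≤ a (2 * r + 2) := hup _ _ (by omega) (by omega) (by omega)
    rw [show 2 * (r + 1) + 1 = 2 * r + 1 + 1 + 1 by ring, sum_range_succ, sum_range_succ]
    have e1 : (-1 : ℝ) ^ (2 * r + 1) = -1 := by rw [pow_succ, pow_mul]; norm_num
    have e2 : (-1 : ℝ) ^ (2 * r + 1 + 1) = 1 := by rw [pow_succ, e1]; norm_num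
    rw [e1, e2, show 2 * r + 1 + 1 = 2 * r + 2 by ring]
    linarith

/-- ★ **The odd-length valley lemma.**  If `a₀, …, a_{2r}` are positive, non-increasing up to an index `p` and
non-decreasing from `p` on (a VALLEY), then `Σ_{m ≤ 2r} (−1)^m a_m > 0`: pair the terms from both ends towards the
bottom of the valley; because the length is odd exactly one unpaired `+` term survives. [folklore] -/
theorem valleyAlt_sum_pos_of_turn (r : ℕ) : ∀ (a : ℕ → ℝ) (p : ℕ), (∀ m, m ≤ 2 * r → 0 < a m) →
    (∀ m m', m ≤ m' → m' ≤ p → m' ≤ 2 * r → a m' ≤ a m) →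
    (∀ m m', p ≤ m → m ≤ m' → m' ≤ 2 * r → a m ≤ a m') →
    0 < ∑ m ∈ range (2 * r + 1), (-1 : ℝ) ^ m * a m := by
  induction r with
  | zero => intro a p hpos _ _; simpa using hpos 0 le_rfl
  | succ r ih =>
    intro a p hpos hdown hup
    by_cases hp : p ≤ 1
    · -- the bottom of the valley is at index ≤ 1: the terms are non-decreasing from index 1 on
      have h := first_le_alt_sum_of_monotoneFrom_one a (r + 1)
        (fun m m' h1 h2 h3 => hup m m' (le_trans hp h1) h2 h3)
      exact lt_of_lt_of_le (hpos 0 (by omega)) h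
    · -- peel the first pair `a 0 - a 1 ≥ 0` and recurse on the shifted sequence
      push Not at hp
      rw [show 2 * (r + 1) + 1 = 2 * r + 1 + 1 + 1 by ring, sum_range_succ', sum_range_succ']
      have h01 : a 1 ≤ a 0 := hdown 0 1 (by omega) (by omega) (by omega)
      have hrec : 0 < ∑ m ∈ range (2 * r + 1), (-1 : ℝ) ^ m * a (m + 1 + 1) := by
        refine ih (fun m => a (m + 1 + 1)) (p - 2) (fun m hm => hpos _ (by omega)) ?_ ?_
        · intro m m' h1 h2 h3; exact hdown _ _ (by omega) (by omega) (by omega)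
        · intro m m' h1 h2 h3; exact hup _ _ (by omega) (by omega) (by omega)
      have e : ∀ m : ℕ, (-1 : ℝ) ^ (m + 1 + 1) * a (m + 1 + 1) = (-1 : ℝ) ^ m * a (m + 1 + 1) := by
        intro m; rw [pow_succ, pow_succ]; ring
      simp only [e, pow_zero, one_mul, zero_add, pow_one]
      linarith

/-- ★ **The odd-length valley lemma, relaxed shape**: it suffices that the sequence is non-increasing on `[0, p]` and
non-decreasing on `[p+1, 2r]` — no comparison between `a p` and `a (p+1)` is needed (the bottom is at `p` or at
`p+1`). This is the shape delivered by a hill-shaped `s` in §3. [folklore] -/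
theorem valleyAlt_sum_pos (r : ℕ) (a : ℕ → ℝ) (p : ℕ) (hpos : ∀ m, m ≤ 2 * r → 0 < a m)
    (hdown : ∀ m m', m ≤ m' → m' ≤ p → m' ≤ 2 * r → a m' ≤ a m)
    (hup : ∀ m m', p + 1 ≤ m → m ≤ m' → m' ≤ 2 * r → a m ≤ a m') :
    0 < ∑ m ∈ range (2 * r + 1), (-1 : ℝ) ^ m * a m := by
  by_cases hc : a p ≤ a (p + 1)
  · -- bottom at `p`
    refine valleyAlt_sum_pos_of_turn r a p hpos hdown ?_
    intro m m' h1 h2 h3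
    rcases Nat.eq_or_lt_of_le h1 with h | h
    · subst h; rcases Nat.eq_or_lt_of_le h2 with h' | h'
      · subst h'; exact le_rfl
      · exact le_trans hc (hup _ _ (by omega) (by omega) h3)
    · exact hup _ _ (by omega) h2 h3
  · -- bottom at `p+1`
    push Not at hc
    refine valleyAlt_sum_pos_of_turn r a (p + 1) hpos ?_ hup
    intro m m' h1 h2 h3
    rcases Nat.eq_or_lt_of_le h2 with h | h
    · subst h; rcases Nat.eq_or_lt_of_le h1 with h' | h'
      · subst h'; exact le_rfl
      · exact le_trans hc.le (hdown _ _ (by omega) le_rfl (by omega))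
    · exact hdown _ _ h1 (by omega) h3

/-! ## §2  `k`-monotone functions on `(0, ∞)` -/

/-- `iterMono k`, the CLASS of `k`-MONOTONE functions on `(0,∞)`: `F` is positive on `(0,∞)` and, recursively, every
forward difference `x ↦ F x − F (x + δ)` (`δ > 0`) lies in `iterMono (k−1)` — a finite-order, strict, derivative-free
version of complete monotonicity (a set of real functions, not a proposition). Only the values of `F` on `(0,∞)`
matter (`iterMono_congr`). [folklore] -/
def iterMono : ℕ → Set (ℝ → ℝ)
  | 0 => {F | ∀ x, 0 < x → 0 < F x}
  | k + 1 => {F | (∀ x, 0 < x → 0 < F x) ∧ ∀ δ, 0 < δ → (fun x => F x - F (x + δ)) ∈ iterMono k}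

/-- A `k`-monotone function is positive on `(0,∞)`. [folklore] -/
theorem iterMono_pos {k : ℕ} {F : ℝ → ℝ} (h : F ∈ iterMono k) {x : ℝ} (hx : 0 < x) : 0 < F x := by
  cases k with | zero => exact h x hx | succ k => exact h.1 x hx

/-- Membership in `iterMono k` only depends on the values on `(0,∞)`. [folklore] -/
theorem iterMono_congr {k : ℕ} :
    ∀ {F G : ℝ → ℝ}, F ∈ iterMono k → (∀ x, 0 < x → F x = G x) → G ∈ iterMono k := by
  induction k with
  | zero => intro F G h hFG x hx; rw [← hFG x hx]; exact h x hx
  | succ k ih =>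
    intro F G h hFG
    refine ⟨fun x hx => by rw [← hFG x hx]; exact h.1 x hx, fun δ hδ => ?_⟩
    refine ih (h.2 δ hδ) (fun x hx => ?_)
    rw [hFG x hx, hFG (x + δ) (by linarith)]

/-- `(k+1)`-monotone implies `k`-monotone. [folklore] -/
theorem iterMono_of_succ {k : ℕ} : ∀ {F : ℝ → ℝ}, F ∈ iterMono (k + 1) → F ∈ iterMono k := by
  induction k with
  | zero => intro F h; exact h.1
  | succ k ih => intro F h; exact ⟨h.1, fun δ hδ => ih (h.2 δ hδ)⟩

/-- The classes decrease in the order: `F ∈ iterMono k' → F ∈ iterMono k` for `k ≤ k'`. [folklore] -/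
theorem iterMono_of_le {k k' : ℕ} (hk : k ≤ k') {F : ℝ → ℝ} (h : F ∈ iterMono k') : F ∈ iterMono k := by
  induction k' with
  | zero => rw [Nat.le_zero.mp hk]; exact h
  | succ k' ih =>
    rcases Nat.eq_or_lt_of_le hk with h' | h'
    · rw [h']; exact h
    · exact ih (Nat.lt_succ_iff.mp h') (iterMono_of_succ h)

/-- A `(k+1)`-monotone function is non-increasing on `(0,∞)`. [folklore] -/
theorem iterMono_antitone {k : ℕ} {F : ℝ → ℝ} (h : F ∈ iterMono (k + 1)) {x y : ℝ} (hx : 0 < x) (hxy : x ≤ y) :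
    F y ≤ F x := by
  rcases eq_or_lt_of_le hxy with h' | h'
  · rw [h']
  · have hd : 0 < F x - F (x + (y - x)) := iterMono_pos (h.2 (y - x) (by linarith)) hx
    rw [show x + (y - x) = y by ring] at hd
    linarith

/-- Sums of `k`-monotone functions are `k`-monotone. [folklore] -/
theorem iterMono_add {k : ℕ} :
    ∀ {F G : ℝ → ℝ}, F ∈ iterMono k → G ∈ iterMono k → (fun x => F x + G x) ∈ iterMono k := by
  induction k with
  | zero => intro F G hF hG x hx; exact add_pos (hF x hx) (hG x hx)
  | succ k ih =>
    intro F G hF hG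
    refine ⟨fun x hx => add_pos (hF.1 x hx) (hG.1 x hx), fun δ hδ => ?_⟩
    have e : (fun x => F x + G x - (F (x + δ) + G (x + δ))) =
        (fun x => (F x - F (x + δ)) + (G x - G (x + δ))) := by
      funext x; ring
    rw [e]
    exact ih (hF.2 δ hδ) (hG.2 δ hδ)

/-- Positive multiples of `k`-monotone functions are `k`-monotone. [folklore] -/
theorem iterMono_smul {k : ℕ} :
    ∀ {F : ℝ → ℝ} {c : ℝ}, 0 < c → F ∈ iterMono k → (fun x => c * F x) ∈ iterMono k := by
  induction k with
  | zero => intro F c hc hF x hx; exact mul_pos hc (hF x hx)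
  | succ k ih =>
    intro F c hc hF
    refine ⟨fun x hx => mul_pos hc (hF.1 x hx), fun δ hδ => ?_⟩
    have e : (fun x => c * F x - c * F (x + δ)) = (fun x => c * (F x - F (x + δ))) := by
      funext x; ring
    rw [e]
    exact ih hc (hF.2 δ hδ)

/-- Right translates `x ↦ F (x + a)`, `a ≥ 0`, of `k`-monotone functions are `k`-monotone. [folklore] -/
theorem iterMono_translate {k : ℕ} :
    ∀ {F : ℝ → ℝ} {a : ℝ}, 0 ≤ a → F ∈ iterMono k → (fun x => F (x + a)) ∈ iterMono k := by
  induction k with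
  | zero => intro F a ha hF x hx; exact hF (x + a) (by linarith)
  | succ k ih =>
    intro F a ha hF
    refine ⟨fun x hx => hF.1 (x + a) (by linarith), fun δ hδ => ?_⟩
    have e : (fun x => F (x + a) - F (x + δ + a)) = (fun x => (fun y => F y - F (y + δ)) (x + a)) := by
      funext x; simp only [add_right_comm x δ a]
    rw [e]
    exact ih ha (hF.2 δ hδ)

/-- Products of `k`-monotone functions are `k`-monotone
(`FG − (FG)(·+δ) = (F − F(·+δ))·G + F(·+δ)·(G − G(·+δ))`). [folklore] -/
theorem iterMono_mul {k : ℕ} :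
    ∀ {F G : ℝ → ℝ}, F ∈ iterMono k → G ∈ iterMono k → (fun x => F x * G x) ∈ iterMono k := by
  induction k with
  | zero => intro F G hF hG x hx; exact mul_pos (hF x hx) (hG x hx)
  | succ k ih =>
    intro F G hF hG
    refine ⟨fun x hx => mul_pos (hF.1 x hx) (hG.1 x hx), fun δ hδ => ?_⟩
    have e : (fun x => F x * G x - F (x + δ) * G (x + δ)) =
        (fun x => (F x - F (x + δ)) * G x + F (x + δ) * (G x - G (x + δ))) := by
      funext x; ring
    rw [e]
    exact iterMono_add (ih (hF.2 δ hδ) (iterMono_of_succ hG))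
      (ih (iterMono_translate hδ.le (iterMono_of_succ hF)) (hG.2 δ hδ))

/-- ★ `x ↦ x⁻¹` is `k`-monotone for every `k`: `x⁻¹ − (x+δ)⁻¹ = δ · x⁻¹ · (x+δ)⁻¹` is a positive multiple of a
product of a member and a translate of a member — induction on `k`. [folklore] -/
theorem iterMono_inv (k : ℕ) : (fun x : ℝ => x⁻¹) ∈ iterMono k := by
  induction k with
  | zero => intro x hx; exact inv_pos.mpr hx
  | succ k ih =>
    refine ⟨fun x hx => inv_pos.mpr hx, fun δ hδ => ?_⟩
    refine iterMono_congr (F := fun x : ℝ => δ * (x⁻¹ * (x + δ)⁻¹))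
      (iterMono_smul hδ (iterMono_mul ih (iterMono_translate hδ.le ih))) (fun x hx => ?_)
    show δ * (x⁻¹ * (x + δ)⁻¹) = x⁻¹ - (x + δ)⁻¹
    have hx' : x ≠ 0 := hx.ne'
    have hxd : x + δ ≠ 0 := by positivity
    field_simp; ring

/-- ★ `x ↦ x⁻¹ · x⁻¹` (`= x⁻²` on `(0,∞)`) is `k`-monotone for every `k` — the integral-free substitute for
`λ⁻² = ∫₀^∞ t e^{−tλ} dt` in the decoupling of the coordinates. [folklore] -/
theorem iterMono_inv_mul_inv (k : ℕ) : (fun x : ℝ => x⁻¹ * x⁻¹) ∈ iterMono k :=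
  iterMono_mul (iterMono_inv k) (iterMono_inv k)

/-! ## §3  The one-coordinate transfer -/

/-- The one-coordinate TRANSFER of `F` along the data `s₀, …, s_{L−1}`:
`transfer L s F x = Σ_{m<L} (−1)^m ∕ s m · F (x + (s m)²)`. [folklore] -/
def transfer (L : ℕ) (s : ℕ → ℝ) (F : ℝ → ℝ) (x : ℝ) : ℝ :=
  ∑ m ∈ range L, (-1 : ℝ) ^ m / s m * F (x + s m ^ 2)

/-- Forward differences commute with the transfer:
`transfer F x − transfer F (x+δ) = transfer (F − F(·+δ)) x`. [folklore] -/
theorem transfer_sub (L : ℕ) (s : ℕ → ℝ) (F : ℝ → ℝ) (δ : ℝ) :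
    (fun x => transfer L s F x - transfer L s F (x + δ)) = transfer L s (fun y => F y - F (y + δ)) := by
  funext x
  unfold transfer
  rw [← sum_sub_distrib]
  exact sum_congr rfl (fun m _ => by rw [add_right_comm x δ (s m ^ 2)]; ring)

/-- ★★ **Positivity of the transfer** at every `x ≥ 0`, for odd `L`, positive hill-shaped `s` and `F` positive and
non-increasing on `(0,∞)` (`F ∈ iterMono 1`): the terms `F (x + (s m)²) ∕ s m` form a positive valley, so §1 applies.
[folklore] -/
theorem transfer_pos {L : ℕ} (hL : Odd L) {s : ℕ → ℝ} (hs0 : ∀ m, m < L → 0 < s m) {p : ℕ}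
    (hs : (∀ m m', m ≤ m' → m' ≤ p → m' < L → s m ≤ s m') ∧
      (∀ m m', p + 1 ≤ m → m ≤ m' → m' < L → s m' ≤ s m))
    {F : ℝ → ℝ} (hF : F ∈ iterMono 1) {x : ℝ} (hx : 0 ≤ x) : 0 < transfer L s F x := by
  obtain ⟨r, rfl⟩ := hL
  unfold transfer
  have e : ∀ m ∈ range (2 * r + 1), (-1 : ℝ) ^ m / s m * F (x + s m ^ 2) =
      (-1 : ℝ) ^ m * ((s m)⁻¹ * F (x + s m ^ 2)) := by
    intro m _; rw [div_eq_mul_inv]; ring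
  rw [sum_congr rfl e]
  have harg : ∀ m, m < 2 * r + 1 → 0 < x + s m ^ 2 := fun m hm => by
    have := hs0 m hm; positivity
  -- comparison of two terms from `s m ≤ s m'`
  have hcmp : ∀ m m', m < 2 * r + 1 → m' < 2 * r + 1 → s m ≤ s m' →
      (s m')⁻¹ * F (x + s m' ^ 2) ≤ (s m)⁻¹ * F (x + s m ^ 2) := by
    intro m m' hm hm' hle
    have h1 : (s m')⁻¹ ≤ (s m)⁻¹ := (inv_le_inv₀ (hs0 m' hm') (hs0 m hm)).mpr hle
    have h2 : F (x + s m' ^ 2) ≤ F (x + s m ^ 2) :=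
      iterMono_antitone hF (harg m hm) (by nlinarith [hs0 m hm, hs0 m' hm'])
    exact mul_le_mul h1 h2 (iterMono_pos hF (harg m' hm')).le (inv_pos.mpr (hs0 m hm)).le
  refine valleyAlt_sum_pos r (fun m => (s m)⁻¹ * F (x + s m ^ 2)) p ?_ ?_ ?_
  · exact fun m hm => mul_pos (inv_pos.mpr (hs0 m (by omega))) (iterMono_pos hF (harg m (by omega)))
  · exact fun m m' h1 h2 h3 => hcmp m m' (by omega) (by omega) (hs.1 m m' h1 h2 (by omega))
  · exact fun m m' h1 h2 h3 => hcmp m' m (by omega) (by omega) (hs.2 m m' h1 h2 (by omega))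

/-- ★★ **The transfer costs one order of monotonicity**: `F ∈ iterMono (k+1) → transfer L s F ∈ iterMono k` for odd
`L` and positive hill-shaped `s` — positivity by `transfer_pos`, differences by `transfer_sub`, induction. [folklore] -/
theorem iterMono_transfer {L : ℕ} (hL : Odd L) {s : ℕ → ℝ} (hs0 : ∀ m, m < L → 0 < s m) {p : ℕ}
    (hs : (∀ m m', m ≤ m' → m' ≤ p → m' < L → s m ≤ s m') ∧
      (∀ m m', p + 1 ≤ m → m ≤ m' → m' < L → s m' ≤ s m))
    (k : ℕ) : ∀ {F : ℝ → ℝ}, F ∈ iterMono (k + 1) → transfer L s F ∈ iterMono k := by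
  induction k with
  | zero => intro F hF x hx; exact transfer_pos hL hs0 hs hF hx.le
  | succ k ih =>
    intro F hF
    refine ⟨fun x hx => transfer_pos hL hs0 hs (iterMono_of_le (by omega) hF) hx.le, fun δ hδ => ?_⟩
    rw [transfer_sub]
    exact ih (hF.2 δ hδ)

/-! ## §4  Summing out all coordinates -/

/-- Splitting a sum over `Fin (n+1) → Fin L` along the first coordinate (`Fin.consEquiv`). [folklore] -/
theorem sum_pi_fin_succ {M : Type*} [AddCommMonoid M] (n L : ℕ) (Φ : (Fin (n + 1) → Fin L) → M) :
    ∑ m : Fin (n + 1) → Fin L, Φ m = ∑ m₀ : Fin L, ∑ m' : Fin n → Fin L, Φ (Fin.cons m₀ m') := by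
  rw [← Fintype.sum_prod_type']
  exact (Fintype.sum_equiv (Fin.consEquiv fun _ : Fin (n + 1) => Fin L)
    (fun q => Φ (Fin.cons q.1 q.2)) Φ (fun q => rfl)).symm

/-- The `(n+1)`-coordinate aliased sum is the TRANSFER, along the data of coordinate `0`, of the `n`-coordinate aliased
sum over the remaining coordinates. [folklore] -/
theorem aliasSum_fin_succ_eq_transfer (n L : ℕ) (s : Fin (n + 1) → ℕ → ℝ) (F : ℝ → ℝ) (x : ℝ) :
    ∑ m : Fin (n + 1) → Fin L, (∏ κ, (-1 : ℝ) ^ (m κ : ℕ) / s κ (m κ)) * F (x + ∑ κ, s κ (m κ) ^ 2) =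
      transfer L (s 0) (fun y => ∑ m' : Fin n → Fin L,
        (∏ κ, (-1 : ℝ) ^ (m' κ : ℕ) / s κ.succ (m' κ)) * F (y + ∑ κ, s κ.succ (m' κ) ^ 2)) x := by
  unfold transfer
  rw [← Fin.sum_univ_eq_sum_range, sum_pi_fin_succ]
  refine Fintype.sum_congr _ _ (fun m₀ => ?_)
  rw [mul_sum]
  refine Fintype.sum_congr _ _ (fun m' => ?_)
  simp only [Fin.prod_univ_succ, Fin.sum_univ_succ, Fin.cons_zero, Fin.cons_succ, add_assoc]
  ring

/-- ★★★ **The iterated transfer**: for `n` positive hill-shaped families `s κ` (`κ : Fin n`), odd `L`, and `F`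
`(n+k)`-monotone, the function
`x ↦ Σ_{m : Fin n → Fin L} (Π_κ (−1)^{m κ} ∕ s κ (m κ)) · F (x + Σ_κ (s κ (m κ))²)`
is `k`-monotone — induction on `n`, one `iterMono_transfer` per coordinate. [folklore] -/
theorem aliasCore_iterMono {L : ℕ} (hL : Odd L) : ∀ (n : ℕ) (s : Fin n → ℕ → ℝ),
    (∀ κ m, m < L → 0 < s κ m) → (∀ κ, ∃ p, ((∀ m m', m ≤ m' → m' ≤ p → m' < L → s κ m ≤ s κ m') ∧
      (∀ m m', p + 1 ≤ m → m ≤ m' → m' < L → s κ m' ≤ s κ m))) →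
    ∀ (k : ℕ) (F : ℝ → ℝ), F ∈ iterMono (n + k) →
    (fun x => ∑ m : Fin n → Fin L,
      (∏ κ, (-1 : ℝ) ^ (m κ : ℕ) / s κ (m κ)) * F (x + ∑ κ, s κ (m κ) ^ 2)) ∈ iterMono k := by
  intro n
  induction n with
  | zero =>
    intro s _ _ k F hF
    refine iterMono_congr (iterMono_of_le (by omega) hF) (fun x _ => ?_)
    rw [Fintype.sum_unique]
    simp only [Finset.univ_eq_empty, Finset.prod_empty, Finset.sum_empty, one_mul, add_zero]
  | succ n ih =>
    intro s hs0 hs k F hF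
    -- sum out the coordinates `1, …, n` first (induction hypothesis at order `k+1`), then coordinate `0`
    have hGm : (fun y => ∑ m' : Fin n → Fin L,
        (∏ κ, (-1 : ℝ) ^ (m' κ : ℕ) / s κ.succ (m' κ)) * F (y + ∑ κ, s κ.succ (m' κ) ^ 2)) ∈ iterMono (k + 1) :=
      ih (fun κ => s κ.succ) (fun κ m hm => hs0 κ.succ m hm) (fun κ => hs κ.succ) (k + 1) F
        (iterMono_of_le (by omega) hF)
    obtain ⟨p, hp⟩ := hs 0
    exact iterMono_congr (iterMono_transfer hL (hs0 0) hp k hGm)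
      (fun x _ => (aliasSum_fin_succ_eq_transfer n L s F x).symm)

/-- ★★★ **Positivity of the aliased sum over `n+1` coordinates**: for positive hill-shaped families `s κ`
(`κ : Fin (n+1)`) below an odd `L` and `F` `k`-monotone for every `k` on `(0,∞)`,
`0 < Σ_{m : Fin (n+1) → Fin L} (Π_κ (−1)^{m κ} ∕ s κ (m κ)) · F (Σ_κ (s κ (m κ))²)` — sum out coordinates `1..n` by
`aliasCore_iterMono` (order `1` left), then `transfer_pos` at `x = 0` along coordinate `0`. [folklore] -/
theorem aliasCore_pos_fin {L : ℕ} (hL : Odd L) (n : ℕ) (s : Fin (n + 1) → ℕ → ℝ)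
    (hs0 : ∀ κ m, m < L → 0 < s κ m)
    (hs : ∀ κ, ∃ p, ((∀ m m', m ≤ m' → m' ≤ p → m' < L → s κ m ≤ s κ m') ∧
      (∀ m m', p + 1 ≤ m → m ≤ m' → m' < L → s κ m' ≤ s κ m)))
    (F : ℝ → ℝ) (hF : ∀ k, F ∈ iterMono k) :
    0 < ∑ m : Fin (n + 1) → Fin L, (∏ κ, (-1 : ℝ) ^ (m κ : ℕ) / s κ (m κ)) * F (∑ κ, s κ (m κ) ^ 2) := by
  have hGm : (fun y => ∑ m' : Fin n → Fin L,
      (∏ κ, (-1 : ℝ) ^ (m' κ : ℕ) / s κ.succ (m' κ)) * F (y + ∑ κ, s κ.succ (m' κ) ^ 2)) ∈ iterMono 1 :=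
    aliasCore_iterMono hL n (fun κ => s κ.succ) (fun κ m hm => hs0 κ.succ m hm) (fun κ => hs κ.succ) 1 F (hF _)
  obtain ⟨p, hp⟩ := hs 0
  have h := aliasSum_fin_succ_eq_transfer n L s F 0
  simp only [zero_add] at h
  rw [h]
  exact transfer_pos hL (hs0 0) hp hGm le_rfl

/-- ★★★ **Positivity of the aliased sum (abstract form, any finite non-empty index type).**  For positive
hill-shaped families `s κ` (`κ : J`) below an odd `L` and `F` `k`-monotone for every `k` on `(0,∞)`:
`0 < Σ_{m : J → Fin L} (Π_κ (−1)^{m κ} ∕ s κ (m κ)) · F (Σ_κ (s κ (m κ))²)` — transport to `J = Fin (n+1)`.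
With `F = x⁻¹·x⁻¹` and the sine data of part 2 this is «`K(θ) > 0`». [folklore] -/
theorem aliasCore_pos {J : Type*} [Fintype J] [DecidableEq J] [Nonempty J] {L : ℕ} (hL : Odd L) (s : J → ℕ → ℝ)
    (hs0 : ∀ κ m, m < L → 0 < s κ m)
    (hs : ∀ κ, ∃ p, ((∀ m m', m ≤ m' → m' ≤ p → m' < L → s κ m ≤ s κ m') ∧
      (∀ m m', p + 1 ≤ m → m ≤ m' → m' < L → s κ m' ≤ s κ m)))
    (F : ℝ → ℝ) (hF : ∀ k, F ∈ iterMono k) :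
    0 < ∑ m : J → Fin L, (∏ κ, (-1 : ℝ) ^ (m κ : ℕ) / s κ (m κ)) * F (∑ κ, s κ (m κ) ^ 2) := by
  obtain ⟨n, hn⟩ : ∃ n, Fintype.card J = n + 1 :=
    ⟨Fintype.card J - 1, by have := Fintype.card_pos (α := J); omega⟩
  let e : J ≃ Fin (n + 1) := Fintype.equivFinOfCardEq hn
  have key : ∑ m : J → Fin L, (∏ κ, (-1 : ℝ) ^ (m κ : ℕ) / s κ (m κ)) * F (∑ κ, s κ (m κ) ^ 2) =
      ∑ m : Fin (n + 1) → Fin L,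
        (∏ i, (-1 : ℝ) ^ (m i : ℕ) / s (e.symm i) (m i)) * F (∑ i, s (e.symm i) (m i) ^ 2) := by
    refine Fintype.sum_equiv (e.arrowCongr (Equiv.refl (Fin L))) _ _ (fun m => ?_)
    have h1 : (∏ κ, (-1 : ℝ) ^ (m κ : ℕ) / s κ (m κ)) =
        ∏ i, (-1 : ℝ) ^ ((e.arrowCongr (Equiv.refl (Fin L)) m) i : ℕ) /
          s (e.symm i) ((e.arrowCongr (Equiv.refl (Fin L)) m) i) :=
      Fintype.prod_equiv e _ _ (fun κ => by simp [Equiv.arrowCongr_apply])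
    have h2 : (∑ κ, s κ (m κ) ^ 2) = ∑ i, s (e.symm i) ((e.arrowCongr (Equiv.refl (Fin L)) m) i) ^ 2 :=
      Fintype.sum_equiv e _ _ (fun κ => by simp [Equiv.arrowCongr_apply])
    rw [h1, h2]
  rw [key]
  exact aliasCore_pos_fin hL n (fun i => s (e.symm i)) (fun i m hm => hs0 _ m hm) (fun i => hs _) F hF

end Summit.QuantumFields.YangMills.Theorems.N07AliasSumPositivity

end
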